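import Summits.Langlands.Langlands.Theses.ParityBlindBianchi
import Literature.NumberTheory.Automorphic.CompletedCohomologyPoints
import Literature.NumberTheory.GaloisRepresentations.IntegralGaloisActionProofs
import Literature.NumberTheory.GaloisRepresentations.FramedRepBaseChange

/-!
# Disproof of `ArtinWeightRealisationLevel` (R′, crux stmt-Langlands-15111, route ParityBlindBianchi) — findings

Crux disprover `cdisprove-stmt-Langlands-15111` (refuter-cdisprove-stmt-Langlands-15111-0), cycle 1,
2026-08-16.  Lean work file (prose only in docstrings); every `theorem` below is sorry-free.

## VERDICT (cycle 1): NO KILL — and no kill is possible short of a counterexample to Artin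
reciprocity for `GL₂` over an imaginary quadratic field.

R′ reads (read-back of the elaborated statement, `W.lean` rc 0): for `K` imaginary quadratic, any
prime `p`, `ι : ℚ̄_p ≃+* ℂ`, `σ : Γ_K → GL₂(ℚ̄_p)` continuous with finite image and (absolutely)
irreducible, and `S₀ : Finset ℕ` with `p ∈ S₀` ("good" place = over no `ℓ ∈ S₀`): IF there are an
open `U ≤ GL₂(𝒪̂_K)` containing `∏_{good} GL₂(𝒪_v)`, uniformisers `ϖ_v`, and `𝒪_{ℚ̄_p}`-valued
`a_{v,1}, a_{v,2}` (`v` good) such that `T_{v,i} ↦ a_{v,i}` is a point of `Spf 𝕋(U^p)` of the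
`p`-power tower (`IsHeckePoint`: continuous `𝒪`-algebra maps `𝕋 → 𝒪/p^t` for all `t`, `𝕋` the
closure of the Hecke algebra acting on ALL `H^i(X_{U ∩ Γ(p^s)}, 𝒪/p^t)`, group cohomology of
`GL₂(K)`) and `σ` is Hansen-associated at every good `v` (`IsHeckeAssociatedAt`: UNRAMIFIED at `v`
and `charpoly σ(Frob_v⁻¹) = X² − a_{v,1}X + q_v a_{v,2}`), THEN some cuspidal `π` of `GL₂(𝔸_K)`
(genuine `CuspidalAutomorphicRepData`, genuine `HasSatakeParamAt`) has, at EVERY good `w`, a Satake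
parameter `α` with `σ` unramified at `w` and `charpoly σ(Frob_w) = ∏ (X − ι⁻¹(α_j⁻¹))`
(`SatakeFrobCompatibleAt`, `m = 1`).  No junk operator (`/`, ℕ-`-`, `tsum`, `sSup`, `0⁻¹` only in
`arithFrobPolyOfSatake` at `a = 0`, excluded by `det ≠ 0`), no silent `[Fintype]`, universes `Type 0`.

WHY IT RESISTS.  (1) The conclusion at `(K, σ)` is an instance of Artin reciprocity for `GL₂/K`
(dictionary: `α(π, w) = ι(roots of X² − a_{w,1}X + q_w a_{w,2})`); by the previous attack's
`artinWeightRealisationLevel_of_strongArtin` (evidence `20260816T080746Z-Evidence.lean` on the item)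
strong Artin over `K` ⇒ R′ using only `IsHeckeAssociatedAt.isUnramifiedAt`, so `¬R′` ⊢ a
finite-image irreducible `σ` over an imaginary quadratic field with NO matching cuspidal `π` —
solvable image is the Langlands–Tunnell / automorphic-induction THEOREM, `A₅` is open; nothing is
exhibitable, and non-automorphy is not provable in any case.  (2) The hypothesis is NOT junk for
irreducible `σ` (analysis §a4 below): the only Hecke points visible without automorphic input are
the degree-`0` Eisenstein systems `T_{v,1} ↦ (q_v+1)ψ(ϖ_v)`, `T_{v,2} ↦ ψ(ϖ_v)²` (constant /
`det`-factoring classes; paper), associated with `ψ ⊕ ψε⁻¹` — reducible, infinite image — and the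
EMPTY family (kernel-checked, §a1).
(3) In Lean neither a Hecke point for an irreducible `σ` (needs E2′-type `R = 𝕋` input) nor the
non-existence of a cuspidal `π` (needs Jacquet–Shalika / the structure of the cuspidal spectrum)
is accessible, so even the natural strengthenings of §c are refutable on paper only.

## INDEX of checked content

* §0 `Hyp` — the hypothesis package verbatim (= the lead's `HypLevel`).
* §a LOAD-BEARING ANALYSIS
  - a1 **`0 ∉ S₀` is MISSING** (typing): with `0 ∈ S₀` no place is good, the Hecke family is
    indexed by an empty type and `Hyp` is PROVABLE (`hyp_of_zero_mem`, via
    `isHeckePoint_of_isEmpty` — constant class in `H⁰`, exact annihilator); R′ ⊢ existence of a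
    Bianchi cusp form given `(K, ι, σ)` (`cuspForms_of_artinWeightRealisationLevel`) and
    **R′ ↔ `ArtinWeightRealisationLevelRepaired ∧ ArtinWeightRealisationLevelZeroSector`**
    (`artinWeightRealisationLevel_iff`).  LANDED as `Theorems/ArtinWeightRealisationLevel/Negative/
    ZeroSector.lean` (p99154).  Consequence for the line `Sketch`: its stub `CuspFormsGL2Exist` is
    FORCED by the crux as typed (not an artefact of the line); consequence for the planner: add
    `0 ∉ S₀` (or `∀ ℓ ∈ S₀, ℓ.Prime`) to the `S₀` binders of E2′ and R′, as already recorded for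
    E1′/D′ (`Theorems/IcosahedralDescentLevel/Negative/AllParityOfDoorOfDescent.lean`).
  - a2 **`p ∈ S₀` is NOT load-bearing**: association at a place over `p` is unsatisfiable for
    finite-image `σ` with `𝒪`-valued eigenvalues (`det σ(Frob⁻¹) = q_v a_{v,2}`, norms `1` vs
    `< 1`: `not_isHeckeAssociatedAt_of_mem`, `places_over_p_bad_of_assoc`), hence
    **`ArtinWeightRealisationLevelWithoutMemS₀ ↔ R′`** (`withoutMemS₀_iff`; transport of `Hyp`
    from `S₀` to `insert p S₀`, `hyp_insert`).  Lemmas LANDED as `…/Negative/PlacesOverP.lean`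
    (p100195).
    For the prover: the binder carries no information; for the planner: harmless decoration.
  - a3 `Finite σ.range`, `IsIrreducible`: load-bearing IN NATURE, not formalisable — §c.
  - a4 `IsHeckePoint ∧ IsHeckeAssociatedAt` (the E2′ package) is the ONLY handle (previous attack's
    `…_of_withoutHeckePoint`).  Junk analysis (paper): a point mod `p^t` factors through the Hecke
    algebra `𝕋_I` of finitely many pieces `H^i(X_{K(s)}, 𝒪/p^{t'})`; `p^{max t'} = 0` in `𝕋_I`, so
    stage `t` needs a piece with `t' ≥ t`; `H⁰ = Fun(GL₂(K)\GL₂(𝔸_f)/K(s), 𝒪/p^{t'})` factors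
    through `det` (strong approximation for `SL₂`, `K` has a complex place) and carries only the
    Eisenstein systems `((q_v+1)ψ(ϖ_v), ψ(ϖ_v)²)` ↔ `ψ ⊕ ψ ε⁻¹` (reducible); at the non-neat level
    `K(0) = U` (the witness may take `U = GL₂(𝒪̂)`, `−1 ∈ Γ_x`) the Farrell classes in degrees `> 2`
    (`p ∣ 2·3·5`) are killed by a bounded power `p^e` (exponent of the finite subgroups), so they
    serve only the stages `t ≤ e`; degrees `1, 2` carry genuine (torsion) Bianchi eigensystems with
    Scholze Galois determinants.  Hence an `𝒪`-point associated with an IRREDUCIBLE `σ` is a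
    genuine `p`-adic (torsion-limit) automorphic eigensystem — the intended open E2′ content; no
    junk witness exists for the disprover, and none makes R′ vacuous either.
* §b TIGHTNESS — "every good place" vs "a.e.": not load-bearing modulo Gelbart 1997 Prop. 4.1
  (σ-unramified shadow): the lead's `RigidityAE`/`crux_of_rigidity` (Lines/Sketch.lean) derive R′
  from the a.e. crux R (stmt-Langlands-11057) + that named fact + a1's cusp form; so R′ ≡ R in
  difficulty, and the planner's kill criterion "a refutation exploiting only every-good-place vs
  a.e. is a typing refutation" is moot — there is no such refutation (σ is unramified at every
  good place by hypothesis, and `π(σ)` is unramified wherever `σ` is).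
* §c NATURAL STRENGTHENINGS (paper refutations; objects not constructible in the tree):
  - drop `IsIrreducible`: `σ = ψ₁ ⊕ χ₂` (finite-order Hecke characters) is an Eisenstein point of
    `Spf 𝕋(U^p)` (`p`-adic limit of the Harder–Eisenstein systems `(ψ₁, N·χ₂)`; `K` abelian over
    `ℚ` so Leopoldt holds and the `GL₁/K` eigenvariety is `2`-dimensional), while no CUSPIDAL `π`
    has Satake parameters `{ψ₁(w), χ₂(w)}` at almost all `w` (Jacquet–Shalika: it would be nearly
    equivalent to the isobaric `ψ₁ ⊞ χ₂`).  So irreducibility is load-bearing.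
  - drop `Finite`: the Galois representation of a cuspidal cohomological Bianchi eigenclass is an
    (irreducible, infinite-image) Hecke point; the `m = 1` conclusion then asks for Satake
    parameters of absolute value `q_w^{1/2}` at every good `w`, i.e. for `π ⊗ |det|^{1/2}`, which is
    not realised on `A_G GL₂(K)\GL₂(𝔸_K)` (the tree's automorphic forms are `A_G`-invariant,
    `AdelicGLnGlue` D10) — finite image is load-bearing for the NORMALISATION, as intended
    ("Artin type, weight 0").
  - drop `p ∈ S₀`: NOT a strengthening (a2).  — drop `0 ∉ S₀`: it is absent (a1).
  - conclusion at EVERY place (drop "good"): false wherever `σ` ramifies (`SatakeFrobCompatibleAt`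
    contains `IsUnramifiedAt`) — trivial, and the reason the good-place restriction is there.
* §d TARGETS / LINE `Sketch` (lead prover-line-stmt-Langlands-15111-0; payload.stuck_stubs = ∅):
  every stub is TRUE — `stub_charpolyDictionary` (2×2 identity `charpoly M = ∏(X − ι⁻¹(a⁻¹)) ↔
  charpoly ι((M⁻¹)ᵀ) = ∏(X − a)`, both sides false iff `0 ∈ α`) is PROVED in §d below (same
  signature as the lead's stub; also attached to the item as `StubCharpolyDictionary.lean`), `stub_cuspFormsGL2Exist` (= a1's zero-sector conjunct,
  FORCED), `frobSatakeCompatibleAt_of_isPiOfArtinRep_of_isUnramifiedAt` (Gelbart 1997 Prop. 4.1 with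
  Thm. 3.2; vacuous for reducible `σ` by JS, true for irreducible; convention-free as the lead notes),
  `stub_artinWeightRealisation` = item 11057 (open, same wall).  Joint sufficiency
  `crux_of_rigidity` is kernel-checked by the lead; no gap is smuggled (`IsHeckeAssociatedAt.
  isUnramifiedAt` supplies the unramifiedness `RigidityAE` consumes).  Nothing to break; the line's
  honest end state is `blocked-on: stmt-Langlands-11057`.
* §e NEAR-MISSES: none (no sorried theorem in this file).

Barriers: `Literature.Barriers.Langlands.NonRegularWeightBarrier` applies verbatim (the item IS the
wall); negatives index (Langlands): 1 unrelated entry (K3KugaSatakeDescent.SerreTypeAnchor) + D′'s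
AllParityOfDoorOfDescent.  Literature searched this cycle: none needed beyond the tree (verdict is
structural); Calegari–Mazur 2008 (characteristic-0 isolation of Artin points off CM components) does
not bear on the torsion-allowed `IsHeckePoint`.

v1 (this file) carries LOCAL COPIES of the lemmas of the two Negative files (namespaced here) until
the proposals are applied; v2 will import `…Theorems.ArtinWeightRealisationLevel.Negative.*` instead.
-/

noncomputable section

set_option linter.dupNamespace false

open CategoryTheory
open scoped NumberField

namespace Summit.Langlands.Langlands.Cruxes.ArtinWeightRealisationLevel.Disproof

open Literature.NumberTheory.Automorphic Literature.NumberTheory.GaloisRepresentations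
  IsDedekindDomain Polynomial

universe u v

/-! ## Local copies of the landed/pending Negative lemmas (ZeroSector.lean, PlacesOverP.lean) -/



/-! ## Hecke points of an empty family of Hecke elements (any tower, any coefficients) -/

section EmptyFamily

variable {k : Type u} [CommRing k] {Γ 𝒢 : Type u} [Group Γ] [Group 𝒢]
variable (ι : Γ →* 𝒢) (L : Subgroup 𝒢) (M : Type u) [AddCommGroup M] [Module k M]

/-- The constant function with value `m` is a `Γ`-invariant of `Fun(𝒢 ⧸ L, M)`. [folklore] -/
theorem const_mem_invariants (m : M) :
    (fun _ : 𝒢 ⧸ L => m) ∈ (ArithmeticQuotient.coeffRep k ι L M).ρ.invariants := by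
  intro γ
  ext c
  simp [ArithmeticQuotient.coeffRep]

/-- A scalar kills the degree-`0` class `[m] ∈ H⁰(X_L, M)` of the constant function `m` (through
Mathlib's `groupCohomology.H0Iso`) iff it kills `m`. [folklore] -/
theorem smul_constClass_eq_zero_iff (a : k) (m : M) :
    a • (groupCohomology.H0Iso (ArithmeticQuotient.coeffRep k ι L M)).inv
        ⟨fun _ => m, const_mem_invariants (k := k) ι L M m⟩ = 0 ↔ a • m = 0 := by
  constructor
  · intro h
    have h1 := congrArg
      (fun x => (groupCohomology.H0Iso (ArithmeticQuotient.coeffRep k ι L M)).hom x) h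
    simp only [map_smul, map_zero] at h1
    have h2 := congrArg
      (fun f : (ArithmeticQuotient.coeffRep k ι L M).ρ.invariants =>
        (f : (𝒢 ⧸ L) → M) ((1 : 𝒢) : 𝒢 ⧸ L)) h1
    simpa using h2
  · intro h
    have h1 : a • (⟨fun _ => m, const_mem_invariants (k := k) ι L M m⟩ :
        (ArithmeticQuotient.coeffRep k ι L M).ρ.invariants) = 0 := by
      ext c
      simp [h]
    rw [← map_smul, h1, map_zero]

/-- The degree-`0` class of a non-zero constant function is non-zero. [folklore] -/
theorem constClass_ne_zero {m : M} (hm : m ≠ 0) :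
    (groupCohomology.H0Iso (ArithmeticQuotient.coeffRep k ι L M)).inv
      ⟨fun _ => m, const_mem_invariants (k := k) ι L M m⟩ ≠ 0 := by
  intro h
  have := (smul_constClass_eq_zero_iff (k := k) ι L M 1 m).1 (by rw [one_smul]; exact h)
  exact hm (by simpa using this)

variable {ι L M}
variable (T : LevelTower 𝒢) (ϖ : k) {J : Type v} (δ : J → 𝒢) (χ : J → k)

/-- **For an EMPTY family of Hecke elements every "system of eigenvalues" occurs** (in degree `0`,
witnessed by the constant class `[1] ∈ H⁰(X_{K(0)}, k/ϖ^{t+1})`, whose annihilator is exactly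
`(ϖ^{t+1})`), provided `ϖ` is not a unit. [folklore] -/
theorem eigensystemOccurs_of_isEmpty [IsEmpty J] (hϖ : ¬ IsUnit ϖ) :
    EigensystemOccurs ι T ϖ δ χ 0 := by
  intro t
  refine ⟨0, (groupCohomology.H0Iso
      (ArithmeticQuotient.coeffRep k ι (T.level 0) (modPow k ϖ (t + 1)))).inv
        ⟨fun _ => 1, const_mem_invariants (k := k) ι (T.level 0) (modPow k ϖ (t + 1)) 1⟩,
    ⟨?_, fun j => isEmptyElim j⟩, ?_⟩
  · apply constClass_ne_zero
    intro h10
    apply hϖ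
    have : Ideal.span {ϖ ^ (t + 1)} = ⊤ := by
      rw [Ideal.eq_top_iff_one]
      exact (Ideal.Quotient.eq_zero_iff_mem).1 h10
    rw [Ideal.span_singleton_eq_top] at this
    exact (isUnit_pow_iff (Nat.succ_ne_zero t)).1 this
  · intro a ha
    rw [smul_constClass_eq_zero_iff, Algebra.smul_def, mul_one] at ha
    exact (Ideal.Quotient.eq_zero_iff_mem).1 ha

/-- **An empty family of Hecke elements has a Hecke point** (`Spf 𝕋(Kᵖ)` is then the formal
spectrum of the closure of the scalars, and `H⁰ ≠ 0` makes the scalars act faithfully modulo every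
`ϖ^t`): `IsHeckePoint` holds for every `χ`, provided `ϖ` is not a unit. [folklore] -/
theorem isHeckePoint_of_isEmpty [IsEmpty J] (hϖ : ¬ IsUnit ϖ) : IsHeckePoint ι T ϖ δ χ :=
  (eigensystemOccurs_of_isEmpty (ι := ι) T ϖ δ χ hϖ).isHeckePoint

end EmptyFamily

/-! ## The zero sector of R′ -/

/-- With `0 ∈ S₀` no finite place of `K` is good. [folklore] -/
theorem isEmpty_good_of_zero_mem {S₀ : Finset ℕ} (h0 : (0 : ℕ) ∈ S₀)
    (K : Type) [Field K] [NumberField K] :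
    IsEmpty {v : HeightOneSpectrum (𝓞 K) // ∀ ℓ ∈ S₀, ((ℓ : ℕ) : 𝓞 K) ∉ v.asIdeal} :=
  ⟨fun v => v.2 0 h0 (by simp)⟩

/-- `p` is not a unit of `𝒪_{ℚ̄_p}` (its valuation is `1/p < 1`). [folklore] -/
theorem not_isUnit_natCast_valuationSubring (p : ℕ) [Fact p.Prime] :
    ¬ IsUnit ((p : ℕ) : (Valued.v (R := PadicAlgCl p)).valuationSubring) := by
  rintro ⟨u, hu⟩
  have h1 : ((u : (Valued.v (R := PadicAlgCl p)).valuationSubring) : PadicAlgCl p) *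
      (((u⁻¹ : ((Valued.v (R := PadicAlgCl p)).valuationSubring)ˣ) :
        (Valued.v (R := PadicAlgCl p)).valuationSubring) : PadicAlgCl p) = 1 := by
    rw [← Subring.coe_mul, Units.mul_inv]
    rfl
  have hv := congrArg (Valued.v : PadicAlgCl p → NNReal) h1
  rw [map_mul, map_one, hu] at hv
  have hle : Valued.v ((((u⁻¹ : ((Valued.v (R := PadicAlgCl p)).valuationSubring)ˣ) :
      (Valued.v (R := PadicAlgCl p)).valuationSubring) : PadicAlgCl p)) ≤ 1 :=
    ((u⁻¹ : ((Valued.v (R := PadicAlgCl p)).valuationSubring)ˣ) :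
      (Valued.v (R := PadicAlgCl p)).valuationSubring).2
  have hp : Valued.v ((((p : ℕ) : (Valued.v (R := PadicAlgCl p)).valuationSubring) : PadicAlgCl p)) =
      1 / (p : NNReal) := by
    rw [show ((((p : ℕ) : (Valued.v (R := PadicAlgCl p)).valuationSubring) : PadicAlgCl p)) =
      (p : PadicAlgCl p) from rfl]
    exact PadicAlgCl.valuation_p p
  rw [hp] at hv
  have hp1 : (1 : NNReal) < p := by exact_mod_cast (Fact.out : p.Prime).one_lt
  have : (1 : NNReal) / p * Valued.v ((((u⁻¹ : ((Valued.v (R := PadicAlgCl p)).valuationSubring)ˣ) :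
      (Valued.v (R := PadicAlgCl p)).valuationSubring) : PadicAlgCl p)) < 1 := by
    calc (1 : NNReal) / p * _ ≤ 1 / p * 1 := by gcongr
      _ < 1 := by
        rw [mul_one, one_div]
        exact inv_lt_one_of_one_lt₀ hp1
  exact absurd hv this.ne

/-- Every finite place has a unit uniformiser in its completion (`valuation_exists_uniformizer`,
`HeightOneSpectrum.valuedAdicCompletion_eq_valuation'`). [folklore] -/
theorem exists_units_uniformizer {K : Type} [Field K] [NumberField K]
    (v : HeightOneSpectrum (𝓞 K)) :
    ∃ ϖ : (v.adicCompletion K)ˣ, Valued.v ((ϖ : (v.adicCompletion K)ˣ) : v.adicCompletion K) =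
      WithZero.exp (-1 : ℤ) := by
  obtain ⟨π, hπ⟩ := v.valuation_exists_uniformizer K
  have hne : ((π : K) : v.adicCompletion K) ≠ 0 := by
    intro h
    have := HeightOneSpectrum.valuedAdicCompletion_eq_valuation' v π
    rw [h, map_zero, hπ] at this
    exact WithZero.coe_ne_zero this.symm
  exact ⟨Units.mk0 _ hne, by rw [Units.val_mk0, HeightOneSpectrum.valuedAdicCompletion_eq_valuation', hπ]⟩

/-- **In the zero sector the hypothesis package of R′ is provable** for every `K`, `p`, `σ`:
`U = GL₂(𝒪̂_K)`, any uniformisers, any eigenvalue family (its domain is empty), the Hecke point of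
the empty family, and a vacuous association clause. [folklore] -/
theorem hyp_of_zero_mem (K : Type) [Field K] [NumberField K] (p : ℕ) [Fact p.Prime]
    (σ : FramedGaloisRep K (PadicAlgCl p) 2) (S₀ : Finset ℕ) (h0 : (0 : ℕ) ∈ S₀) :
    ∃ (U : Subgroup (GL (Fin 2) (IsDedekindDomain.FiniteAdeleRing (NumberField.RingOfIntegers K) K))) (ϖ : ∀ v : IsDedekindDomain.HeightOneSpectrum (NumberField.RingOfIntegers K), (v.adicCompletion K)ˣ) (a : {v : IsDedekindDomain.HeightOneSpectrum (NumberField.RingOfIntegers K) // ∀ ℓ ∈ S₀, ((ℓ : ℕ) : NumberField.RingOfIntegers K) ∉ v.asIdeal} → ℕ → (Valued.v (R := PadicAlgCl p)).valuationSubring), IsOpen (U : Set (GL (Fin 2) (IsDedekindDomain.FiniteAdeleRing (NumberField.RingOfIntegers K) K))) ∧ U ≤ Literature.NumberTheory.Automorphic.glFiniteIntegralLevel 2 K ∧ (∀ g ∈ Literature.NumberTheory.Automorphic.glFiniteIntegralLevel 2 K, (∀ v : IsDedekindDomain.HeightOneSpectrum (NumberField.RingOfIntegers K), ¬ (∀ ℓ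 ∈ S₀, ((ℓ : ℕ) : NumberField.RingOfIntegers K) ∉ v.asIdeal) → ∀ i j : Fin 2, ((g : Matrix (Fin 2) (Fin 2) (IsDedekindDomain.FiniteAdeleRing (NumberField.RingOfIntegers K) K)) i j) v = (1 : Matrix (Fin 2) (Fin 2) (v.adicCompletion K)) i j) → g ∈ U) ∧ (∀ v : IsDedekindDomain.HeightOneSpectrum (NumberField.RingOfIntegers K), Valued.v ((ϖ v : (v.adicCompletion K)ˣ) : v.adicCompletion K) = WithZero.exp (-1 : ℤ)) ∧ Literature.NumberTheory.Automorphic.IsHeckePoint (Matrix.GeneralLinearGroup.map (n := Fin 2) (algebraMap K (IsDedekindDomain.FiniteAdeleRing (NumberField.RingOfIntegers K) K))) (Literature.NumberTheory.Automorphic.LevelTower.ofSeq U (fun r : ℕ => (Literature.NumberTheory.Automorphic.principalCongruenceLevel 2 K (Ideal.span {((p : ℕ) : NumberField.RingOfIntegers K)} ^ r)).map (Literature.NumberTheory.Automorphic.GLn.sndHom 2 K))) ((p : ℕ) : (Valued.v (R := PadicAlgCl p)).valuationSubring) (fun j : {v : IsDedekindDomain.HeightOneSpectrum (NumberField.RingOfIntegers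 K) // ∀ ℓ ∈ S₀, ((ℓ : ℕ) : NumberField.RingOfIntegers K) ∉ v.asIdeal} × Fin 2 => Literature.NumberTheory.Automorphic.GLn.sndHom 2 K (Literature.NumberTheory.Automorphic.heckeDiagAt 2 K j.1.1 (ϖ j.1.1) (j.2.val + 1))) (fun j => a j.1 (j.2.val + 1)) ∧ ∀ (v : IsDedekindDomain.HeightOneSpectrum (NumberField.RingOfIntegers K)) (hv : ∀ ℓ ∈ S₀, ((ℓ : ℕ) : NumberField.RingOfIntegers K) ∉ v.asIdeal), σ.IsHeckeAssociatedAt v (fun i : ℕ => if i = 0 then (1 : PadicAlgCl p) else ((a ⟨v, hv⟩ i : (Valued.v (R := PadicAlgCl p)).valuationSubring) : PadicAlgCl p)) := by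
  haveI := isEmpty_good_of_zero_mem h0 K
  refine ⟨glFiniteIntegralLevel 2 K, fun v => Classical.choose (exists_units_uniformizer v),
    fun v => isEmptyElim v, isOpen_glFiniteIntegralLevel 2 K, le_rfl, fun g hg _ => hg,
    fun v => Classical.choose_spec (exists_units_uniformizer v), ?_, fun v hv => ?_⟩
  · exact isHeckePoint_of_isEmpty _ _ _ _ (not_isUnit_natCast_valuationSubring p)
  · exact isEmptyElim (⟨v, hv⟩ : {v : HeightOneSpectrum (𝓞 K) // ∀ ℓ ∈ S₀, ((ℓ : ℕ) : 𝓞 K) ∉ v.asIdeal})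

open Summit.Langlands.Langlands.Theses.ParityBlindBianchi

/-- **R′ proves the zero-sector conjunct** — the bare existence of a cuspidal automorphic
representation of `GL₂(𝔸_K)` for every imaginary quadratic `K` carrying a field isomorphism
`ι : ℚ̄_p ≃+* ℂ` and an irreducible finite-image `σ : Γ_K → GL₂(ℚ̄_p)`: feed R′ the bad set
`{0, p}` and the provable hypothesis package of the zero sector (`hyp_of_zero_mem`); no place is
good, so its conclusion is `∃ hcpt π, True`.  Any proof of R′ as typed must therefore produce a
Bianchi cusp form out of `(K, ι, σ)` alone. [folklore] -/
theorem cuspForms_of_artinWeightRealisationLevel (h : ArtinWeightRealisationLevel)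
    (K : Type) [Field K] [NumberField K] (htc : NumberField.IsTotallyComplex K)
    (hdeg : Module.finrank ℚ K = 2) (p : ℕ) [Fact p.Prime] (ι : PadicAlgCl p ≃+* ℂ)
    (σ : FramedGaloisRep K (PadicAlgCl p) 2) (hfin : Finite σ.toMonoidHom.range)
    (hirr : σ.toGaloisRep.IsIrreducible) :
    ∃ hcpt : isCompact_glFiniteIntegralLevel 2 K, Nonempty (CuspidalAutomorphicRepData 2 K hcpt) := by
  obtain ⟨hcpt, π, -⟩ := h K htc hdeg p ι σ hfin hirr {0, p} (by simp)
    (hyp_of_zero_mem K p σ {0, p} (by simp))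
  exact ⟨hcpt, ⟨π⟩⟩

/-- **In the zero sector R′ says nothing about `σ`**: for `0 ∈ S₀` the instance of R′ at
`(K, p, ι, σ, S₀)` — hypothesis package included — follows from the mere existence of a cuspidal
automorphic representation of `GL₂(𝔸_K)` (the compatibility clause quantifies over no place).
[folklore] -/
theorem instance_of_zero_mem_of_cuspForms (K : Type) [Field K] [NumberField K] (p : ℕ)
    [Fact p.Prime] (ι : PadicAlgCl p ≃+* ℂ) (σ : FramedGaloisRep K (PadicAlgCl p) 2)
    (S₀ : Finset ℕ) (h0 : (0 : ℕ) ∈ S₀)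
    (hC : ∃ hcpt : isCompact_glFiniteIntegralLevel 2 K, Nonempty (CuspidalAutomorphicRepData 2 K hcpt)) :
    ∃ (hcpt : isCompact_glFiniteIntegralLevel 2 K) (π : CuspidalAutomorphicRepData 2 K hcpt),
      ∀ w : HeightOneSpectrum (𝓞 K), (∀ ℓ ∈ S₀, ((ℓ : ℕ) : 𝓞 K) ∉ w.asIdeal) →
        SatakeFrobCompatibleAt ι π.1 σ w := by
  obtain ⟨hcpt, ⟨π⟩⟩ := hC
  haveI := isEmpty_good_of_zero_mem h0 K
  exact ⟨hcpt, π, fun w hw =>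
    isEmptyElim (⟨w, hw⟩ : {v : HeightOneSpectrum (𝓞 K) // ∀ ℓ ∈ S₀, ((ℓ : ℕ) : 𝓞 K) ∉ v.asIdeal})⟩


section PlacesOverP


variable {K : Type} [Field K] [NumberField K] {p : ℕ} [Fact p.Prime]

/-- The residue cardinality of a place over `p` is a positive power of `p`
(`N v ∣ N((p)) = p^{[K:ℚ]}`, `N v > 1`). [folklore] -/
theorem residueCard_eq_prime_pow (v : HeightOneSpectrum (𝓞 K))
    (hv : ((p : ℕ) : 𝓞 K) ∈ v.asIdeal) : ∃ f : ℕ, 0 < f ∧ v.residueCard = p ^ f := by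
  have h1 : Ideal.absNorm v.asIdeal ∣ Ideal.absNorm (Ideal.span {((p : ℕ) : 𝓞 K)}) :=
    Ideal.absNorm_dvd_absNorm_of_le ((Ideal.span_singleton_le_iff_mem _).mpr hv)
  rw [Ideal.absNorm_span_singleton, show ((p : ℕ) : 𝓞 K) = algebraMap ℤ (𝓞 K) (p : ℤ) by simp,
    Algebra.norm_algebraMap, Int.natAbs_pow, Int.natAbs_natCast] at h1
  obtain ⟨f, -, hfeq⟩ := (Nat.dvd_prime_pow (Fact.out : p.Prime)).1 h1
  refine ⟨f, Nat.pos_of_ne_zero ?_, hfeq⟩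
  rintro rfl
  have := v.one_lt_residueCard
  rw [show v.residueCard = Ideal.absNorm v.asIdeal from rfl, hfeq, pow_zero] at this
  exact lt_irrefl _ this

/-- At a place over `p`, `‖q_v‖_p < 1` in `ℚ̄_p`. [folklore] -/
theorem norm_natCast_residueCard_lt_one (v : HeightOneSpectrum (𝓞 K))
    (hv : ((p : ℕ) : 𝓞 K) ∈ v.asIdeal) : ‖(v.residueCard : PadicAlgCl p)‖ < 1 := by
  obtain ⟨f, hf, hfeq⟩ := residueCard_eq_prime_pow v hv
  rw [hfeq, Nat.cast_pow, norm_pow]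
  have hp : ‖(p : PadicAlgCl p)‖ < 1 := by
    rw [← map_natCast (algebraMap ℚ_[p] (PadicAlgCl p)) p]
    change ‖((p : ℚ_[p]) : PadicAlgCl p)‖ < 1
    rw [PadicAlgCl.norm_extends]
    exact Padic.norm_p_lt_one
  exact pow_lt_one₀ (norm_nonneg _) hp hf.ne'

omit [NumberField K] in
/-- For `σ` of finite image every `det σ(g)` is a root of unity, hence of `p`-adic absolute value
`1`. [folklore] -/
theorem norm_det_eq_one_of_finite (σ : FramedGaloisRep K (PadicAlgCl p) 2)
    (hfin : Finite σ.toMonoidHom.range) (g : Field.absoluteGaloisGroup K) :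
    ‖((σ g : GL (Fin 2) (PadicAlgCl p)) : Matrix (Fin 2) (Fin 2) (PadicAlgCl p)).det‖ = 1 := by
  haveI := hfin
  have hfo : IsOfFinOrder (⟨σ.toMonoidHom g, ⟨g, rfl⟩⟩ : σ.toMonoidHom.range) :=
    isOfFinOrder_of_finite _
  obtain ⟨n, hn, hpow⟩ := hfo.exists_pow_eq_one
  have hpow' : (σ g : GL (Fin 2) (PadicAlgCl p)) ^ n = 1 := by
    have h := congrArg Subtype.val hpow
    simp only [Subgroup.coe_pow, Subgroup.coe_one] at h
    exact h
  have hdet : (((σ g : GL (Fin 2) (PadicAlgCl p)) : Matrix (Fin 2) (Fin 2) (PadicAlgCl p)).det) ^ n = 1 := by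
    rw [← Matrix.det_pow, ← Units.val_pow_eq_pow_val, hpow', Units.val_one, Matrix.det_one]
  have := congrArg norm hdet
  rw [norm_pow, norm_one] at this
  exact (pow_eq_one_iff_of_nonneg (norm_nonneg _) hn.ne').1 this

/-- The constant coefficient of Hansen's degree-`2` Hecke–Frobenius polynomial
`X² − t₁ X + q t₂` is `q · t₂`. [folklore] -/
theorem coeff_zero_heckeFrobPoly_two {A : Type*} [CommRing A] (q : ℕ) (t : ℕ → A) :
    (heckeFrobPoly q 2 t).coeff 0 = (q : A) * t 2 := by
  unfold heckeFrobPoly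
  simp [Finset.sum_range_succ, Polynomial.coeff_X_pow]

/-- **No association over `p` with `p`-integral `t₂`.**  For `σ : Γ_K → GL₂(ℚ̄_p)` of finite image,
a place `v` over `p` and eigenvalues `t` with `‖t 2‖ ≤ 1`, Hansen's association
`charpoly σ(Frob_v⁻¹) = X² − t₁ X + q_v t₂` fails: constant coefficients give
`det σ(Frob_v⁻¹) = q_v t₂`, of absolute value `1` on the left and `< 1` on the right.
[folklore] -/
theorem not_isHeckeAssociatedAt_of_mem (σ : FramedGaloisRep K (PadicAlgCl p) 2)
    (hfin : Finite σ.toMonoidHom.range) (v : HeightOneSpectrum (𝓞 K))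
    (hv : ((p : ℕ) : 𝓞 K) ∈ v.asIdeal) (t : ℕ → PadicAlgCl p) (ht : ‖t 2‖ ≤ 1) :
    ¬ σ.IsHeckeAssociatedAt v t := by
  intro h
  obtain ⟨𝔓, h𝔓⟩ := v.primesAbove_nonempty
  obtain ⟨φ, hφ⟩ := HeightOneSpectrum.exists_isArithFrobAt_of_mem_primesAbove_holds h𝔓
  have hchar := h.2 𝔓 h𝔓 φ hφ
  have h0 := congrArg (fun P : (PadicAlgCl p)[X] => P.coeff 0) hchar
  simp only [coeff_zero_heckeFrobPoly_two] at h0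
  have hdet : ((σ φ⁻¹ : GL (Fin 2) (PadicAlgCl p)) : Matrix (Fin 2) (Fin 2) (PadicAlgCl p)).det =
      (v.residueCard : PadicAlgCl p) * t 2 := by
    rw [Matrix.det_eq_sign_charpoly_coeff, ← h0]
    simp [FramedRep.charpoly]
  have h1 := norm_det_eq_one_of_finite σ hfin φ⁻¹
  rw [hdet, norm_mul] at h1
  have h2 := norm_natCast_residueCard_lt_one (p := p) v hv
  nlinarith [norm_nonneg (t 2), norm_nonneg ((v.residueCard : ℕ) : PadicAlgCl p)]

/-- **Under the association clause of R′'s hypothesis package no place over `p` is good** (the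
eigenvalues are `𝒪_{ℚ̄_p}`-valued, so `‖a_{v,2}‖ ≤ 1`): the binder `p ∈ S₀` is implied by the rest
of the package, up to the choice of `S₀`. [folklore] -/
theorem places_over_p_bad_of_assoc (σ : FramedGaloisRep K (PadicAlgCl p) 2)
    (hfin : Finite σ.toMonoidHom.range) (S₀ : Finset ℕ)
    (a : {v : HeightOneSpectrum (𝓞 K) // ∀ ℓ ∈ S₀, ((ℓ : ℕ) : 𝓞 K) ∉ v.asIdeal} → ℕ →
      (Valued.v (R := PadicAlgCl p)).valuationSubring)
    (hassoc : ∀ (v : HeightOneSpectrum (𝓞 K)) (hv : ∀ ℓ ∈ S₀, ((ℓ : ℕ) : 𝓞 K) ∉ v.asIdeal),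
      σ.IsHeckeAssociatedAt v (fun i : ℕ => if i = 0 then (1 : PadicAlgCl p) else
        ((a ⟨v, hv⟩ i : (Valued.v (R := PadicAlgCl p)).valuationSubring) : PadicAlgCl p)))
    (v : HeightOneSpectrum (𝓞 K)) (hv : ((p : ℕ) : 𝓞 K) ∈ v.asIdeal) :
    ¬ (∀ ℓ ∈ S₀, ((ℓ : ℕ) : 𝓞 K) ∉ v.asIdeal) := by
  intro hgood
  refine not_isHeckeAssociatedAt_of_mem σ hfin v hv _ ?_ (hassoc v hgood)
  simp only [OfNat.ofNat_ne_zero, if_false]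
  have : Valued.v (((a ⟨v, hgood⟩ 2 : (Valued.v (R := PadicAlgCl p)).valuationSubring) : PadicAlgCl p)) ≤ 1 :=
    (a ⟨v, hgood⟩ 2).2
  rw [PadicAlgCl.valuation_def] at this
  exact_mod_cast this

/-- Corollary: **in the hypothesis package of R′ with `S₀ = ∅` (or any `S₀` avoiding `p`) the
association clause is unsatisfiable** — every place over `p` would be good.  So the mutation
"replace `p ∈ S₀` by `p ∉ S₀`" makes R′ vacuously true, not false. [folklore] -/
theorem assoc_false_of_forall_good (σ : FramedGaloisRep K (PadicAlgCl p) 2)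
    (hfin : Finite σ.toMonoidHom.range) (S₀ : Finset ℕ)
    (hS : ∀ v : HeightOneSpectrum (𝓞 K), ((p : ℕ) : 𝓞 K) ∈ v.asIdeal →
      ∀ ℓ ∈ S₀, ((ℓ : ℕ) : 𝓞 K) ∉ v.asIdeal)
    (a : {v : HeightOneSpectrum (𝓞 K) // ∀ ℓ ∈ S₀, ((ℓ : ℕ) : 𝓞 K) ∉ v.asIdeal} → ℕ →
      (Valued.v (R := PadicAlgCl p)).valuationSubring)
    (hassoc : ∀ (v : HeightOneSpectrum (𝓞 K)) (hv : ∀ ℓ ∈ S₀, ((ℓ : ℕ) : 𝓞 K) ∉ v.asIdeal),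
      σ.IsHeckeAssociatedAt v (fun i : ℕ => if i = 0 then (1 : PadicAlgCl p) else
        ((a ⟨v, hv⟩ i : (Valued.v (R := PadicAlgCl p)).valuationSubring) : PadicAlgCl p))) :
    False := by
  -- a place over `p` exists: a prime factor of `(p) ≠ ⊤`
  have hne : Ideal.span {((p : ℕ) : 𝓞 K)} ≠ ⊤ := by
    rw [Ne, Ideal.span_singleton_eq_top]
    intro hu
    have h4 := hu.map (Algebra.norm ℤ)
    rw [show ((p : ℕ) : 𝓞 K) = algebraMap ℤ (𝓞 K) (p : ℤ) by simp, Algebra.norm_algebraMap,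
      NumberField.RingOfIntegers.rank, isUnit_pow_iff (Module.finrank_pos).ne',
      Int.isUnit_iff_natAbs_eq, Int.natAbs_natCast] at h4
    exact (Fact.out : p.Prime).one_lt.ne' h4
  obtain ⟨𝔭, h𝔭max, hle⟩ := Ideal.exists_le_maximal _ hne
  have h𝔭0 : 𝔭 ≠ ⊥ := by
    intro h
    rw [h, le_bot_iff, Ideal.span_singleton_eq_bot] at hle
    exact (Fact.out : p.Prime).ne_zero (by exact_mod_cast hle)
  let v : HeightOneSpectrum (𝓞 K) := ⟨𝔭, h𝔭max.isPrime, h𝔭0⟩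
  have hv : ((p : ℕ) : 𝓞 K) ∈ v.asIdeal := hle (Ideal.mem_span_singleton_self _)
  exact places_over_p_bad_of_assoc σ hfin S₀ a hassoc v hv (hS v hv)


end PlacesOverP

/-! ## §0 The hypothesis package and the mutated statements -/

/-- The hypothesis package of R′ at `(K, p, σ, S₀)`, verbatim (= the line lead's `HypLevel`). -/
def Hyp (K : Type) [Field K] [NumberField K] (p : ℕ) [Fact p.Prime]
    (σ : FramedGaloisRep K (PadicAlgCl p) 2) (S₀ : Finset ℕ) : Prop :=
  ∃ (U : Subgroup (GL (Fin 2) (IsDedekindDomain.FiniteAdeleRing (NumberField.RingOfIntegers K) K))) (ϖ : ∀ v : IsDedekindDomain.HeightOneSpectrum (NumberField.RingOfIntegers K), (v.adicCompletion K)ˣ) (a : {v : IsDedekindDomain.HeightOneSpectrum (NumberField.RingOfIntegers K) // ∀ ℓ ∈ S₀, ((ℓ : ℕ) : NumberField.RingOfIntegers K) ∉ v.asIdeal} → ℕ → (Valued.v (R := PadicAlgCl p)).valuationSubring), IsOpen (U : Set (GL (Fin 2) (IsDedekindDomain.FiniteAdeleRing (NumberField.RingOfIntegers K) K))) ∧ U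 ≤ Literature.NumberTheory.Automorphic.glFiniteIntegralLevel 2 K ∧ (∀ g ∈ Literature.NumberTheory.Automorphic.glFiniteIntegralLevel 2 K, (∀ v : IsDedekindDomain.HeightOneSpectrum (NumberField.RingOfIntegers K), ¬ (∀ ℓ ∈ S₀, ((ℓ : ℕ) : NumberField.RingOfIntegers K) ∉ v.asIdeal) → ∀ i j : Fin 2, ((g : Matrix (Fin 2) (Fin 2) (IsDedekindDomain.FiniteAdeleRing (NumberField.RingOfIntegers K) K)) i j) v = (1 : Matrix (Fin 2) (Fin 2) (v.adicCompletion K)) i j) → g ∈ U) ∧ (∀ v : IsDedekindDomain.HeightOneSpectrum (NumberField.RingOfIntegers K), Valued.v ((ϖ v : (v.adicCompletion K)ˣ) : v.adicCompletion K) = WithZero.exp (-1 : ℤ)) ∧ Literature.NumberTheory.Automorphic.IsHeckePoint (Matrix.GeneralLinearGroup.map (n := Fin 2) (algebraMap K (IsDedekindDomain.FiniteAdeleRing (NumberField.RingOfIntegers K) K))) (Literature.NumberTheory.Automorphic.LevelTower.ofSeq U (fun r : ℕ => (Literature.NumberTheory.Automorphic.principalCongruenceLevel 2 K (Ideal.span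 {((p : ℕ) : NumberField.RingOfIntegers K)} ^ r)).map (Literature.NumberTheory.Automorphic.GLn.sndHom 2 K))) ((p : ℕ) : (Valued.v (R := PadicAlgCl p)).valuationSubring) (fun j : {v : IsDedekindDomain.HeightOneSpectrum (NumberField.RingOfIntegers K) // ∀ ℓ ∈ S₀, ((ℓ : ℕ) : NumberField.RingOfIntegers K) ∉ v.asIdeal} × Fin 2 => Literature.NumberTheory.Automorphic.GLn.sndHom 2 K (Literature.NumberTheory.Automorphic.heckeDiagAt 2 K j.1.1 (ϖ j.1.1) (j.2.val + 1))) (fun j => a j.1 (j.2.val + 1)) ∧ ∀ (v : IsDedekindDomain.HeightOneSpectrum (NumberField.RingOfIntegers K)) (hv : ∀ ℓ ∈ S₀, ((ℓ : ℕ) : NumberField.RingOfIntegers K) ∉ v.asIdeal), σ.IsHeckeAssociatedAt v (fun i : ℕ => if i = 0 then (1 : PadicAlgCl p) else ((a ⟨v, hv⟩ i : (Valued.v (R := PadicAlgCl p)).valuationSubring) : PadicAlgCl p))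

/-- The conclusion of R′ at `(K, p, ι, σ, S₀)`, verbatim. -/
def Concl (K : Type) [Field K] [NumberField K] (p : ℕ) [Fact p.Prime] (ι : PadicAlgCl p ≃+* ℂ)
    (σ : FramedGaloisRep K (PadicAlgCl p) 2) (S₀ : Finset ℕ) : Prop :=
  ∃ (hcpt : Literature.NumberTheory.Automorphic.isCompact_glFiniteIntegralLevel 2 K) (π : Literature.NumberTheory.Automorphic.CuspidalAutomorphicRepData 2 K hcpt), ∀ w : IsDedekindDomain.HeightOneSpectrum (NumberField.RingOfIntegers K), (∀ ℓ ∈ S₀, ((ℓ : ℕ) : NumberField.RingOfIntegers K) ∉ w.asIdeal) → SatakeFrobCompatibleAt ι π.1 σ w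

open Summit.Langlands.Langlands.Theses.ParityBlindBianchi

/-- R′ unfolded through `Hyp`/`Concl` (definitional). -/
theorem crux_iff : ArtinWeightRealisationLevel ↔
    ∀ (K : Type) [Field K] [NumberField K], NumberField.IsTotallyComplex K → Module.finrank ℚ K = 2 →
      ∀ (p : ℕ) [Fact p.Prime] (ι : PadicAlgCl p ≃+* ℂ) (σ : FramedGaloisRep K (PadicAlgCl p) 2),
        Finite σ.toMonoidHom.range → σ.toGaloisRep.IsIrreducible →
          ∀ S₀ : Finset ℕ, p ∈ S₀ → Hyp K p σ S₀ → Concl K p ι σ S₀ :=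
  Iff.rfl

/-! ## §a1 The zero sector: `R′ ↔ Repaired ∧ ZeroSector` -/

/-- **The zero-sector conjunct of R′** (true, foreign to the mechanism): existence of a cuspidal
automorphic representation of `GL₂(𝔸_K)` given `(K, ι, σ)`. -/
def ArtinWeightRealisationLevelZeroSector : Prop :=
  ∀ (K : Type) [Field K] [NumberField K], NumberField.IsTotallyComplex K → Module.finrank ℚ K = 2 →
    ∀ (p : ℕ) [Fact p.Prime] (_ι : PadicAlgCl p ≃+* ℂ) (σ : FramedGaloisRep K (PadicAlgCl p) 2),
      Finite σ.toMonoidHom.range → σ.toGaloisRep.IsIrreducible →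
        ∃ hcpt : isCompact_glFiniteIntegralLevel 2 K, Nonempty (CuspidalAutomorphicRepData 2 K hcpt)

/-- **R′ repaired** (the planner's minimal repair `C′`): R′ with the side condition `0 ∉ S₀`. -/
def ArtinWeightRealisationLevelRepaired : Prop :=
  ∀ (K : Type) [Field K] [NumberField K], NumberField.IsTotallyComplex K → Module.finrank ℚ K = 2 →
    ∀ (p : ℕ) [Fact p.Prime] (ι : PadicAlgCl p ≃+* ℂ) (σ : FramedGaloisRep K (PadicAlgCl p) 2),
      Finite σ.toMonoidHom.range → σ.toGaloisRep.IsIrreducible →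
        ∀ S₀ : Finset ℕ, p ∈ S₀ → (0 : ℕ) ∉ S₀ → Hyp K p σ S₀ → Concl K p ι σ S₀

/-- **R′ = repaired R′ ∧ zero sector** (kernel-checked split of the crux). -/
theorem artinWeightRealisationLevel_iff :
    ArtinWeightRealisationLevel ↔
      ArtinWeightRealisationLevelRepaired ∧ ArtinWeightRealisationLevelZeroSector := by
  refine ⟨fun h => ⟨fun K _ _ htc hdeg p _ ι σ hfin hirr S₀ hp _ hyp =>
      h K htc hdeg p ι σ hfin hirr S₀ hp hyp,
    fun K _ _ htc hdeg p _ ι σ hfin hirr =>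
      cuspForms_of_artinWeightRealisationLevel h K htc hdeg p ι σ hfin hirr⟩, fun ⟨hR, hZ⟩ => ?_⟩
  intro K _ _ htc hdeg p _ ι σ hfin hirr S₀ hp hyp
  by_cases h0 : (0 : ℕ) ∈ S₀
  · exact instance_of_zero_mem_of_cuspForms K p ι σ S₀ h0 (hZ K htc hdeg p ι σ hfin hirr)
  · exact hR K htc hdeg p ι σ hfin hirr S₀ hp h0 hyp

/-! ## §a2 `p ∈ S₀` is removable: `WithoutMemS₀ ↔ R′` -/

section Transport

variable {k : Type u} [CommRing k] {Γ 𝒢 : Type u} [Group Γ] [Group 𝒢]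
  (ι : Γ →* 𝒢) (T : LevelTower 𝒢) (ϖ : k) {J J' : Type v}

/-- Re-indexing the generating Hecke family along an equivalence does not change the generated
(dense) Hecke algebra (credit: line lead, `Lines/Sketch.lean`, `towerHeckeAlgebra_comp_equiv`). -/
theorem towerHeckeAlgebra_comp_equiv (e : J' ≃ J) (δ : J → 𝒢) :
    towerHeckeAlgebra k ι T ϖ (δ ∘ e) = towerHeckeAlgebra k ι T ϖ δ := by
  unfold towerHeckeAlgebra
  congr 1
  ext x
  simp only [Set.mem_range, Function.comp_apply]
  exact ⟨fun ⟨j, hj⟩ => ⟨e j, hj⟩, fun ⟨j, hj⟩ => ⟨e.symm j, by simpa using hj⟩⟩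

/-- … nor the big Hecke algebra (credit: line lead, `Lines/Sketch.lean`). -/
theorem bigHeckeAlgebra_comp_equiv (e : J' ≃ J) (δ : J → 𝒢) :
    bigHeckeAlgebra k ι T ϖ (δ ∘ e) = bigHeckeAlgebra k ι T ϖ δ := by
  ext x
  change (∀ I : Finset TowerIndex, ∃ a ∈ towerHeckeAlgebra k ι T ϖ (δ ∘ e), ∀ y ∈ I, x y = a y) ↔
    (∀ I : Finset TowerIndex, ∃ a ∈ towerHeckeAlgebra k ι T ϖ δ, ∀ y ∈ I, x y = a y)
  rw [towerHeckeAlgebra_comp_equiv]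

/-- … nor the notion of Hecke point (credit: line lead, `Lines/Sketch.lean`,
`isHeckePoint_comp_equiv`). -/
theorem isHeckePoint_comp_equiv (e : J' ≃ J) (δ : J → 𝒢) (χ : J → k) :
    IsHeckePoint ι T ϖ (δ ∘ e) (χ ∘ e) ↔ IsHeckePoint ι T ϖ δ χ := by
  have hB := bigHeckeAlgebra_comp_equiv ι T ϖ e δ
  constructor
  · intro h t
    obtain ⟨I, φ, hcont, hgen⟩ := h t
    refine ⟨I, φ.comp (Subalgebra.equivOfEq _ _ hB.symm).toAlgHom, ?_, ?_⟩
    · intro x y hxy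
      simp only [AlgHom.comp_apply]
      exact hcont _ _ fun z hz => by simpa using hxy z hz
    · intro j
      have h1 : ((Subalgebra.equivOfEq _ _ hB.symm).toAlgHom
          ⟨towerHeckeFamily k ι T ϖ (δ j), towerHeckeFamily_mem_bigHeckeAlgebra k ι T ϖ δ j⟩ :
            bigHeckeAlgebra k ι T ϖ (δ ∘ e)) =
          ⟨towerHeckeFamily k ι T ϖ ((δ ∘ e) (e.symm j)),
            towerHeckeFamily_mem_bigHeckeAlgebra k ι T ϖ (δ ∘ e) (e.symm j)⟩ := by
        apply Subtype.ext
        simp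
      have h2 := hgen (e.symm j)
      simp only [Function.comp_apply, Equiv.apply_symm_apply] at h2
      rw [AlgHom.comp_apply, h1]
      simpa using h2
  · intro h t
    obtain ⟨I, φ, hcont, hgen⟩ := h t
    refine ⟨I, φ.comp (Subalgebra.equivOfEq _ _ hB).toAlgHom, ?_, ?_⟩
    · intro x y hxy
      simp only [AlgHom.comp_apply]
      exact hcont _ _ fun z hz => by simpa using hxy z hz
    · intro j
      have h1 : ((Subalgebra.equivOfEq _ _ hB).toAlgHom
          ⟨towerHeckeFamily k ι T ϖ ((δ ∘ e) j), towerHeckeFamily_mem_bigHeckeAlgebra k ι T ϖ (δ ∘ e) j⟩ :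
            bigHeckeAlgebra k ι T ϖ δ) =
          ⟨towerHeckeFamily k ι T ϖ (δ (e j)), towerHeckeFamily_mem_bigHeckeAlgebra k ι T ϖ δ (e j)⟩ := by
        apply Subtype.ext
        simp
      rw [AlgHom.comp_apply, h1]
      exact hgen (e j)

end Transport

/-- **Transport of the package to `insert p S₀`.**  Under `Hyp K p σ S₀` (finite-image `σ`) the
places over `p` are already bad (`places_over_p_bad_of_assoc`), so `S₀` and `insert p S₀` have the
SAME good places and the package moves across unchanged (family re-indexed along the equivalence of
the two subtypes, `isHeckePoint_comp_equiv`). -/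
theorem hyp_insert {K : Type} [Field K] [NumberField K] {p : ℕ} [Fact p.Prime]
    {σ : FramedGaloisRep K (PadicAlgCl p) 2} (hfin : Finite σ.toMonoidHom.range) {S₀ : Finset ℕ}
    (h : Hyp K p σ S₀) : Hyp K p σ (insert p S₀) := by
  obtain ⟨U, ϖ, a, hopen, hle, hlev, hϖ, hpt, hassoc⟩ := h
  -- same good places
  have hgood : ∀ v : HeightOneSpectrum (𝓞 K),
      (∀ ℓ ∈ insert p S₀, ((ℓ : ℕ) : 𝓞 K) ∉ v.asIdeal) ↔ (∀ ℓ ∈ S₀, ((ℓ : ℕ) : 𝓞 K) ∉ v.asIdeal) := by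
    intro v
    refine ⟨fun h ℓ hℓ => h ℓ (Finset.mem_insert_of_mem hℓ), fun h ℓ hℓ => ?_⟩
    rcases Finset.mem_insert.1 hℓ with rfl | hℓ
    · intro hpv
      exact places_over_p_bad_of_assoc σ hfin S₀ a hassoc v hpv h
    · exact h ℓ hℓ
  let e : {v : HeightOneSpectrum (𝓞 K) // ∀ ℓ ∈ insert p S₀, ((ℓ : ℕ) : 𝓞 K) ∉ v.asIdeal} ≃
      {v : HeightOneSpectrum (𝓞 K) // ∀ ℓ ∈ S₀, ((ℓ : ℕ) : 𝓞 K) ∉ v.asIdeal} :=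
    Equiv.subtypeEquivRight hgood
  let E : {v : HeightOneSpectrum (𝓞 K) // ∀ ℓ ∈ insert p S₀, ((ℓ : ℕ) : 𝓞 K) ∉ v.asIdeal} × Fin 2 ≃
      {v : HeightOneSpectrum (𝓞 K) // ∀ ℓ ∈ S₀, ((ℓ : ℕ) : 𝓞 K) ∉ v.asIdeal} × Fin 2 :=
    e.prodCongr (Equiv.refl _)
  refine ⟨U, ϖ, fun v => a (e v), hopen, hle, fun g hg hgS => hlev g hg fun v hv => hgS v ?_, hϖ,
    ?_, fun v hv => hassoc v ((hgood v).1 hv)⟩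
  · exact fun h => hv ((hgood v).1 h)
  · exact (isHeckePoint_comp_equiv
      (Matrix.GeneralLinearGroup.map (n := Fin 2) (algebraMap K (FiniteAdeleRing (𝓞 K) K)))
      (LevelTower.ofSeq U (fun r : ℕ =>
        (principalCongruenceLevel 2 K (Ideal.span {((p : ℕ) : 𝓞 K)} ^ r)).map (GLn.sndHom 2 K)))
      ((p : ℕ) : (Valued.v (R := PadicAlgCl p)).valuationSubring) E
      (fun j : {v : HeightOneSpectrum (𝓞 K) // ∀ ℓ ∈ S₀, ((ℓ : ℕ) : 𝓞 K) ∉ v.asIdeal} × Fin 2 =>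
        GLn.sndHom 2 K (heckeDiagAt 2 K j.1.1 (ϖ j.1.1) (j.2.val + 1)))
      (fun j => a j.1 (j.2.val + 1))).mpr hpt

/-- **R′ without the binder `p ∈ S₀`** (hypothesis mutation). -/
def ArtinWeightRealisationLevelWithoutMemS₀ : Prop :=
  ∀ (K : Type) [Field K] [NumberField K], NumberField.IsTotallyComplex K → Module.finrank ℚ K = 2 →
    ∀ (p : ℕ) [Fact p.Prime] (ι : PadicAlgCl p ≃+* ℂ) (σ : FramedGaloisRep K (PadicAlgCl p) 2),
      Finite σ.toMonoidHom.range → σ.toGaloisRep.IsIrreducible →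
        ∀ S₀ : Finset ℕ, Hyp K p σ S₀ → Concl K p ι σ S₀

/-- **`p ∈ S₀` is removable**: the mutated crux is EQUIVALENT to the crux (so the binder is neither
a handle for the disprover nor information for the prover). -/
theorem withoutMemS₀_iff : ArtinWeightRealisationLevelWithoutMemS₀ ↔ ArtinWeightRealisationLevel := by
  refine ⟨fun h K _ _ htc hdeg p _ ι σ hfin hirr S₀ _ hyp => h K htc hdeg p ι σ hfin hirr S₀ hyp,
    fun h K _ _ htc hdeg p _ ι σ hfin hirr S₀ hyp => ?_⟩
  obtain ⟨hcpt, π, hπ⟩ := h K htc hdeg p ι σ hfin hirr (insert p S₀) (Finset.mem_insert_self p S₀)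
    (hyp_insert hfin hyp)
  refine ⟨hcpt, π, fun w hw => hπ w fun ℓ hℓ => ?_⟩
  rcases Finset.mem_insert.1 hℓ with rfl | hℓ
  · intro hpw
    obtain ⟨U, ϖ, a, -, -, -, -, -, hassoc⟩ := hyp
    exact places_over_p_bad_of_assoc σ hfin S₀ a hassoc w hpw hw
  · exact hw ℓ hℓ

/-- **The mutation `S₀` avoiding `p` is VACUOUS, not false**: if every place over `p` is good then
`Hyp` is unsatisfiable (`assoc_false_of_forall_good`), so R′ restricted to such `S₀` holds
trivially. -/
theorem concl_of_hyp_of_forall_good {K : Type} [Field K] [NumberField K] {p : ℕ} [Fact p.Prime]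
    (ι : PadicAlgCl p ≃+* ℂ) {σ : FramedGaloisRep K (PadicAlgCl p) 2}
    (hfin : Finite σ.toMonoidHom.range) {S₀ : Finset ℕ}
    (hS : ∀ v : HeightOneSpectrum (𝓞 K), ((p : ℕ) : 𝓞 K) ∈ v.asIdeal →
      ∀ ℓ ∈ S₀, ((ℓ : ℕ) : 𝓞 K) ∉ v.asIdeal)
    (h : Hyp K p σ S₀) : Concl K p ι σ S₀ := by
  obtain ⟨U, ϖ, a, -, -, -, -, -, hassoc⟩ := h
  exact (assoc_false_of_forall_good σ hfin S₀ hS a hassoc).elim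

/-! ## §a1 ∧ §a2 combined: the honest core of the crux -/

/-- **The core of R′**: `0 ∉ S₀` added, `p ∈ S₀` dropped.  R′ ↔ core ∧ zero sector. -/
def ArtinWeightRealisationLevelCore : Prop :=
  ∀ (K : Type) [Field K] [NumberField K], NumberField.IsTotallyComplex K → Module.finrank ℚ K = 2 →
    ∀ (p : ℕ) [Fact p.Prime] (ι : PadicAlgCl p ≃+* ℂ) (σ : FramedGaloisRep K (PadicAlgCl p) 2),
      Finite σ.toMonoidHom.range → σ.toGaloisRep.IsIrreducible →
        ∀ S₀ : Finset ℕ, (0 : ℕ) ∉ S₀ → Hyp K p σ S₀ → Concl K p ι σ S₀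

/-- **R′ ↔ core ∧ zero sector.** -/
theorem artinWeightRealisationLevel_iff_core :
    ArtinWeightRealisationLevel ↔
      ArtinWeightRealisationLevelCore ∧ ArtinWeightRealisationLevelZeroSector := by
  rw [artinWeightRealisationLevel_iff]
  refine and_congr_left fun _ => ⟨fun hR K _ _ htc hdeg p _ ι σ hfin hirr S₀ h0 hyp => ?_,
    fun hC K _ _ htc hdeg p _ ι σ hfin hirr S₀ _ h0 hyp => hC K htc hdeg p ι σ hfin hirr S₀ h0 hyp⟩
  have h0' : (0 : ℕ) ∉ insert p S₀ := by
    rw [Finset.mem_insert, not_or]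
    exact ⟨(Fact.out : p.Prime).ne_zero.symm, h0⟩
  obtain ⟨hcpt, π, hπ⟩ := hR K htc hdeg p ι σ hfin hirr (insert p S₀) (Finset.mem_insert_self p S₀)
    h0' (hyp_insert hfin hyp)
  refine ⟨hcpt, π, fun w hw => hπ w fun ℓ hℓ => ?_⟩
  rcases Finset.mem_insert.1 hℓ with rfl | hℓ
  · intro hpw
    obtain ⟨U, ϖ, a, -, -, -, -, -, hassoc⟩ := hyp
    exact places_over_p_bad_of_assoc σ hfin S₀ a hassoc w hpw hw
  · exact hw ℓ hℓ



/-! ## Route-level corollary: the zero sector of E2′ (`TwoAdicBianchiProModularityLevel`) is free -/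

/-- **E2′ in the zero sector is a theorem**: for `0 ∈ S₀` the conclusion package of
`TwoAdicBianchiProModularityLevel` (= `Hyp K 2 σ S₀`) holds outright (`hyp_of_zero_mem`), whatever
the residual hypothesis.  (So in the chain `closes`, a junk `S₀ ∋ 0` from E1′ makes E2′ free, R′ cost
one Bianchi cusp form, and D′ carry the target — cf. the previous attack's `closes_without_E2'_R'`
and `Theorems/IcosahedralDescentLevel/Negative/AllParityOfDoorOfDescent.lean`.) -/
theorem e2'_instance_of_zero_mem (K : Type) [Field K] [NumberField K]
    (σ : FramedGaloisRep K (PadicAlgCl 2) 2) (S₀ : Finset ℕ) (h0 : (0 : ℕ) ∈ S₀) :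
    Hyp K 2 σ S₀ :=
  hyp_of_zero_mem K 2 σ S₀ h0

/-- The conclusion of E2′ at `(K, σ, S₀)` is literally `Hyp K 2 σ S₀` (definitional check against the
route file: E2′'s conclusion package = R′'s hypothesis package at `p = 2`). -/
theorem twoAdicBianchiProModularityLevel_iff :
    TwoAdicBianchiProModularityLevel ↔
      ∀ (K : Type) [Field K] [NumberField K], NumberField.IsTotallyComplex K → Module.finrank ℚ K = 2 →
        (∃ v w : IsDedekindDomain.HeightOneSpectrum (NumberField.RingOfIntegers K), v ≠ w ∧
          ((2 : ℕ) : NumberField.RingOfIntegers K) ∈ v.asIdeal ∧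
            ((2 : ℕ) : NumberField.RingOfIntegers K) ∈ w.asIdeal) →
        ∀ (ι : PadicAlgCl 2 ≃+* ℂ) (σ : FramedGaloisRep K (PadicAlgCl 2) 2),
          Finite σ.toMonoidHom.range → σ.toGaloisRep.IsIrreducible →
            Nonempty ((Matrix.ProjGenLinGroup.mk.comp σ.toMonoidHom).range ≃* alternatingGroup (Fin 5)) →
              ∀ S₀ : Finset ℕ, 2 ∈ S₀ →
                (∃ (hcpt : isCompact_glFiniteIntegralLevel 2 K) (π₀ : CuspidalAutomorphicRepData 2 K hcpt),
                  π₀.1.IsRegularAlgebraic ∧ ∀ v : IsDedekindDomain.HeightOneSpectrum (NumberField.RingOfIntegers K),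
                    (∀ ℓ ∈ S₀, ((ℓ : ℕ) : NumberField.RingOfIntegers K) ∉ v.asIdeal) →
                      ∃ (α : Multiset ℂ) (P : Polynomial (PadicAlgCl 2)), π₀.1.HasSatakeParamAt v α ∧
                        σ.IsUnramifiedAt v ∧ σ.HasFrobCharpolyAt v P ∧
                          ∀ i : ℕ, ‖P.coeff i - (arithFrobPolyOfSatake ι v.residueCard 2 α).coeff i‖ < 1) →
                Hyp K 2 σ S₀ :=
  Iff.rfl

/-! ## §d Line `Sketch`: the worker stub `stub_charpolyDictionary`, PROVED -/

section LineSketch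

open scoped Matrix

/-- Two monic quadratics `X² − sX + t` agree iff their coefficients do. [folklore] -/
theorem quad_eq_quad_iff {F : Type*} [CommRing F] [Nontrivial F] (s t s' t' : F) :
    (X ^ 2 - C s * X + C t : F[X]) = X ^ 2 - C s' * X + C t' ↔ s = s' ∧ t = t' := by
  constructor
  · intro h
    have h0 := congrArg (fun P : F[X] => P.coeff 0) h
    have h1 := congrArg (fun P : F[X] => P.coeff 1) h
    simp at h0 h1
    exact ⟨h1, h0⟩
  · rintro ⟨rfl, rfl⟩
    rfl

/-- **`stub_charpolyDictionary` of line `Sketch`, proved.** [folklore] -/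
theorem stub_charpolyDictionary {p : ℕ} [Fact p.Prime] (ι : PadicAlgCl p ≃+* ℂ) (q : ℕ)
    (M : GL (Fin 2) (PadicAlgCl p)) (α : Multiset ℂ) (hα : Multiset.card α = 2) :
    (M : Matrix (Fin 2) (Fin 2) (PadicAlgCl p)).charpoly = arithFrobPolyOfSatake ι q 1 α ↔
      ((((M⁻¹ : GL (Fin 2) (PadicAlgCl p)) : Matrix (Fin 2) (Fin 2) (PadicAlgCl p))ᵀ).map
          (ι : PadicAlgCl p → ℂ)).charpoly = satakePolynomial α := by
  obtain ⟨a, b, rfl⟩ := Multiset.card_eq_two.1 hα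
  -- the two target polynomials, expanded
  have hL : arithFrobPolyOfSatake ι q 1 {a, b} =
      X ^ 2 - C (ι.symm a⁻¹ + ι.symm b⁻¹) * X + C (ι.symm a⁻¹ * ι.symm b⁻¹) := by
    rw [arithFrobPolyOfSatake_one, Multiset.insert_eq_cons, Multiset.map_cons,
      Multiset.prod_cons, Multiset.map_singleton, Multiset.prod_singleton]
    simp only [map_add, map_mul]
    ring
  have hR : satakePolynomial {a, b} = X ^ 2 - C (a + b) * X + C (a * b) := by
    rw [satakePolynomial, Multiset.insert_eq_cons, Multiset.map_cons, Multiset.prod_cons,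
      Multiset.map_singleton, Multiset.prod_singleton]
    simp only [C_add, C_mul]
    ring
  -- the right-hand characteristic polynomial in terms of `tr M`, `det M`
  set T : PadicAlgCl p := (M : Matrix (Fin 2) (Fin 2) (PadicAlgCl p)).trace with hT
  set D : PadicAlgCl p := (M : Matrix (Fin 2) (Fin 2) (PadicAlgCl p)).det with hD
  have hDne : D ≠ 0 := by
    rw [hD]
    exact (Matrix.isUnits_det_units M).ne_zero
  have hM : (M : Matrix (Fin 2) (Fin 2) (PadicAlgCl p)).charpoly = X ^ 2 - C T * X + C D :=
    Matrix.charpoly_fin_two _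
  have hinv : ((((M⁻¹ : GL (Fin 2) (PadicAlgCl p)) : Matrix (Fin 2) (Fin 2) (PadicAlgCl p))ᵀ).map
      (ι : PadicAlgCl p → ℂ)).charpoly = X ^ 2 - C (ι (T / D)) * X + C (ι D⁻¹) := by
    rw [Matrix.transpose_map, Matrix.charpoly_transpose, Matrix.coe_units_inv,
      show (ι : PadicAlgCl p → ℂ) = (ι.toRingHom : PadicAlgCl p → ℂ) from rfl, Matrix.charpoly_map,
      charpoly_inv_of_charpoly_eq_fin_two hM]
    simp [Polynomial.map_sub, Polynomial.map_add, Polynomial.map_mul, Polynomial.map_pow]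
  rw [hL, hR, hM, hinv, quad_eq_quad_iff, quad_eq_quad_iff]
  -- pure field algebra in `ℂ` after transporting `T`, `D` along `ι`
  have key : ∀ x : PadicAlgCl p, ∀ y : ℂ, x = ι.symm y ↔ ι x = y := fun x y =>
    ⟨fun h => by rw [h, RingEquiv.apply_symm_apply], fun h => by rw [← h, RingEquiv.symm_apply_apply]⟩
  rw [show ι.symm a⁻¹ + ι.symm b⁻¹ = ι.symm (a⁻¹ + b⁻¹) by rw [map_add],
    show ι.symm a⁻¹ * ι.symm b⁻¹ = ι.symm (a⁻¹ * b⁻¹) by rw [map_mul], key, key, map_div₀, map_inv₀]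
  set t : ℂ := ι T
  set d : ℂ := ι D with hd
  have hdne : d ≠ 0 := by rw [hd]; exact (map_ne_zero ι).2 hDne
  by_cases ha : a = 0
  · subst ha
    simp only [inv_zero, zero_add, zero_mul, inv_eq_zero]
    exact ⟨fun ⟨_, h⟩ => absurd h hdne, fun ⟨_, h⟩ => absurd h hdne⟩
  by_cases hb : b = 0
  · subst hb
    simp only [inv_zero, add_zero, mul_zero, inv_eq_zero]
    exact ⟨fun ⟨_, h⟩ => absurd h hdne, fun ⟨_, h⟩ => absurd h hdne⟩
  constructor
  · rintro ⟨h1, h2⟩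
    refine ⟨?_, ?_⟩
    · rw [h1, h2]; field_simp; ring
    · rw [h2]; field_simp
  · rintro ⟨h1, h2⟩
    have h2' : d = a⁻¹ * b⁻¹ := by
      rw [← inv_inv d, h2, mul_inv]
    refine ⟨?_, h2'⟩
    rw [div_eq_iff hdne] at h1
    rw [h1, h2']
    field_simp
    ring

end LineSketch

end Summit.Langlands.Langlands.Cruxes.ArtinWeightRealisationLevel.Disproof

end
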